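import Mathlib
import HarnessLib
import Summits.Ventures.LatticeQCDFlow.Scoring.FreeEnergyCLT
import Summits.Ventures.LatticeQCDFlow.Scoring.KishESSConsistency
import Summits.Ventures.LatticeQCDFlow.Scoring.SelfNormalisedReweightingStudentisedCLT

/-!
# An ERROR BAR for the printed free energy, from the card alone: the STUDENTISED CLT
# `√n (log Ẑₙ − log Z)/√(1/Kₙ − 1) ⇒ N(0, 1)` — the `(1/ESS − 1)/n` rule made exact, with the
# printed Kish fraction `Kₙ` supplying the variance

HONEST FRAMING: exact (Metropolis-corrected) sampling algorithms for lattice gauge theory;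
figures of merit are autocorrelation/cost numbers at stated couplings and volumes; no
continuum-physics claim.

Venture `LatticeQCDFlow` (cell pub-lqcd), topic `Scoring`; FANOUT row 4 (`s0-u1-b`, rung S0-B).
Sequel of `Scoring/FreeEnergyCLT` (`√n (log Ẑₙ − log Z) ⇒ N(0, M₂ − 1)`) and
`Scoring/KishESSConsistency` (the printed Kish fraction `Kₙ → 1/M₂` almost surely), both
imported: the asymptotic variance `M₂ − 1 = 1/ESS − 1` of the free-energy estimate is itself
consistently estimated by the PRINTED `1/Kₙ − 1`, so Slutsky
(`continuous_comp_prodMk_of_tendstoInMeasure_const` with `g(x, v) = x/√(max(v, s/2))`,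
`s = M₂ − 1 > 0`) and the eventual-agreement argument of
`Scoring/SelfNormalisedReweightingStudentisedCLT` give
**`√n (log Ẑₙ − log Z)/√(1/Kₙ − 1) ⇒ N(0, 1)`**: the interval `log Ẑₙ ± z·√((1/Kₙ − 1)/n)` has
asymptotically exact coverage for `log Z`, with NOTHING but printed quantities in it.  The
non-degeneracy `M₂ > 1` says the model is not the target (`p ≠ q` on a set of positive
measure).  Printed counterparts NAMED ONLY (nothing cited as a fact): Kong–Liu–Wong (1994);
Shirts–Chodera (2008).  NEW WORK of the cell; no definition is introduced.

## Content (`ν = μ.withDensity q`, `w = p/q`, `w̃ = c·w`, `c = Z > 0`, `M₂ = ∫ p²/q dμ`)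

* `invKishFrac_sub_one_tendsto_ae` — `1/Kₙ − 1 → M₂ − 1` almost surely;
* **`logPartitionFunction_studentised_clt`** — THE THEOREM (`M₂ > 1`, `p²/q ∈ L¹`,
  `Y₁ ∼ N(0, 1)`).

NOT CLAIMED: the degenerate case `M₂ = 1`; the finite-`n` bias of `log Ẑₙ`; dependence along a
chain; any number of ours re-scored.
-/

noncomputable section

namespace Summit.Ventures.LatticeQCDFlow.Scoring.CardConsistency

open MeasureTheory ProbabilityTheory Finset Real Filter
open scoped Topology Function

section Studentised

variable {Ω : Type*} [MeasurableSpace Ω] {P : Measure Ω} [IsProbabilityMeasure P]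
variable {Ω' : Type*} [MeasurableSpace Ω'] {P' : Measure Ω'} [IsProbabilityMeasure P']
variable {X : Type*} [MeasurableSpace X] {μ : Measure X} {p q : X → ℝ} {y : ℕ → Ω → X}
variable {Y₁ : Ω' → ℝ}

/-- **The printed variance estimate of the free energy is strongly consistent**:
`1/Kₙ − 1 → M₂ − 1` almost surely (`Kₙ` the printed Kish fraction, any `c ≠ 0`). [ours] -/
theorem invKishFrac_sub_one_tendsto_ae (hym : ∀ j, Measurable (y j)) (hind : iIndepFun y P)
    (hlaw : ∀ j, Measure.map (y j) P = μ.withDensity fun z => ENNReal.ofReal (q z))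
    (hpm : Measurable p) (hpi : Integrable p μ) (hp1 : ∫ z, p z ∂μ = 1) (hq0 : ∀ z, 0 < q z)
    (hqm : Measurable q) (hM2i : Integrable (fun z => p z ^ 2 / q z) μ) {wt : X → ℝ} {c : ℝ}
    (hc : c ≠ 0) (hwt : ∀ z, wt z = c * (p z / q z)) :
    ∀ᵐ ω ∂P, Tendsto (fun n : ℕ => (kishESS (range n) (fun i => wt (y i ω)) / n)⁻¹ - 1) atTop
      (𝓝 ((∫ z, p z ^ 2 / q z ∂μ) - 1)) := by
  haveI hν : IsProbabilityMeasure (μ.withDensity fun z => ENNReal.ofReal (q z)) :=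
    hlaw 0 ▸ Measure.isProbabilityMeasure_map (hym 0).aemeasurable
  have hM0 : (∫ z, p z ^ 2 / q z ∂μ)⁻¹ ≠ 0 := inv_ne_zero
    (one_pos.trans_le (KishESSMedian.one_le_secondMoment_model hν hpm hpi hp1 hq0 hqm hM2i)).ne'
  filter_upwards [kishFrac_tendsto_ae hym hind hlaw hpm hpi hp1 hq0 hqm hM2i hc hwt] with ω hK
  have h := (hK.inv₀ hM0).sub_const 1
  rwa [inv_inv] at h

/-- **THE STUDENTISED CLT FOR THE PRINTED FREE ENERGY (an asymptotically exact error bar from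
the card alone).**  One independent proposal stream `yᵢ` (laws `ν = μ.withDensity q`); `p`
measurable, integrable, `∫ p dμ = 1`, `p²/q ∈ L¹(μ)` with `M₂ = ∫ p²/q dμ > 1` (the model is not
the target); `q > 0` measurable; weights printed as `w̃ = c·p/q` with the true constant `c > 0`;
`Y₁` standard normal.  With `Ẑₙ = Σ_{i<n} w̃ᵢ/n` and `Kₙ` the printed Kish fraction:
`√n (log Ẑₙ − log c)/√(1/Kₙ − 1) ⇒ Y₁` in distribution. [ours] -/
theorem logPartitionFunction_studentised_clt (hym : ∀ j, Measurable (y j)) (hind : iIndepFun y P)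
    (hlaw : ∀ j, Measure.map (y j) P = μ.withDensity fun z => ENNReal.ofReal (q z))
    (hpm : Measurable p) (hpi : Integrable p μ) (hp1 : ∫ z, p z ∂μ = 1) (hq0 : ∀ z, 0 < q z)
    (hqm : Measurable q) (hM2i : Integrable (fun z => p z ^ 2 / q z) μ)
    (hM2 : 1 < ∫ z, p z ^ 2 / q z ∂μ) {wt : X → ℝ} {c : ℝ} (hc : 0 < c)
    (hwt : ∀ z, wt z = c * (p z / q z)) (hY1 : HasLaw Y₁ (gaussianReal 0 1) P') :
    TendstoInDistribution (fun (n : ℕ) ω => Real.sqrt n *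
        (Real.log ((∑ i ∈ range n, wt (y i ω)) / n) - Real.log c)
        / Real.sqrt ((kishESS (range n) (fun i => wt (y i ω)) / n)⁻¹ - 1))
      atTop Y₁ (fun _ => P) P' := by
  obtain ⟨s, hs⟩ : ∃ s : ℝ, s = (∫ z, p z ^ 2 / q z ∂μ) - 1 := ⟨_, rfl⟩
  have hs0 : 0 < s := by
    rw [hs]
    linarith
  have hwf : wt = fun z => c * (p z / q z) := funext hwt
  have hwtm : Measurable wt := hwf ▸ (hpm.div hqm).const_mul c
  -- the CLT with limit `√s·Y₁ ∼ N(0, s)`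
  have hYg : HasLaw (fun ω' => Real.sqrt s * Y₁ ω')
      (gaussianReal 0 ((∫ z, p z ^ 2 / q z ∂μ) - 1).toNNReal) P' :=
    hs ▸ hasLaw_sqrt_mul_gaussian hY1 hs0.le
  have hclt := logPartitionFunction_clt (P' := P') hym hind hlaw hpm hpi hp1 hq0 hqm hM2i hc
    hwt hYg
  -- the printed variance estimate `1/Kₙ − 1 → s` almost surely
  have hVae := invKishFrac_sub_one_tendsto_ae hym hind hlaw hpm hpi hp1 hq0 hqm hM2i hc.ne' hwt
  rw [← hs] at hVae
  have hKm : ∀ n : ℕ, Measurable fun ω => kishESS (range n) (fun i => wt (y i ω)) / (n : ℝ) := by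
    intro n
    unfold kishESS
    exact (((Finset.measurable_sum _ fun j _ => hwtm.comp (hym j)).pow_const 2).div
      (Finset.measurable_sum _ fun j _ => (hwtm.comp (hym j)).pow_const 2)).div_const _
  have hVm : ∀ n : ℕ, Measurable fun ω =>
      (kishESS (range n) (fun i => wt (y i ω)) / (n : ℝ))⁻¹ - 1 := fun n =>
    (hKm n).inv.sub_const 1
  have hV := tendstoInMeasure_of_tendsto_ae (fun n => (hVm n).aestronglyMeasurable) hVae
  -- Slutsky with `g(x, v) = x/√(max(v, s/2))`
  have hden : ∀ v : ℝ, Real.sqrt (max v (s / 2)) ≠ 0 := fun v =>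
    (Real.sqrt_pos.2 (lt_max_of_lt_right (half_pos hs0))).ne'
  have hgc : Continuous fun z : ℝ × ℝ => z.1 / Real.sqrt (max z.2 (s / 2)) :=
    continuous_fst.div (continuous_snd.max continuous_const).sqrt fun z => hden z.2
  have hsl := hclt.continuous_comp_prodMk_of_tendstoInMeasure_const hgc hV
    (fun n => (hVm n).aemeasurable)
  have elim : (fun ω' => Real.sqrt s * Y₁ ω' / Real.sqrt (max s (s / 2))) = Y₁ := by
    funext ω'
    rw [max_eq_left (by linarith), mul_div_assoc, mul_div_left_comm,
      div_self (Real.sqrt_pos.2 hs0).ne', mul_one]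
  rw [elim] at hsl
  -- the printed statistic agrees with the Slutsky statistic eventually, almost surely
  have hXm : ∀ n : ℕ, Measurable fun ω => Real.sqrt n *
      (Real.log ((∑ i ∈ range n, wt (y i ω)) / n) - Real.log c) := fun n =>
    ((Real.measurable_log.comp ((Finset.measurable_sum _ fun i _ =>
      hwtm.comp (hym i)).div_const _)).sub_const _).const_mul _
  refine tendstoInDistribution_of_tendstoInMeasure_sub (μ'' := P) (μ' := P') _ Y₁ hsl ?_
    (fun n => ((hXm n).div (hVm n).sqrt).aemeasurable)
  refine tendstoInMeasure_of_tendsto_ae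
    (fun n => (((hXm n).div (hVm n).sqrt).sub ((hXm n).div ((hVm n).max
      measurable_const).sqrt)).aestronglyMeasurable) ?_
  filter_upwards [hVae] with ω hVω
  refine (tendsto_const_nhds (x := (0 : ℝ))).congr' ?_
  filter_upwards [hVω.eventually_const_lt (half_lt_self hs0)] with n hn
  rw [Pi.sub_apply, Pi.sub_apply, max_eq_left hn.le, sub_self]

end Studentised

end Summit.Ventures.LatticeQCDFlow.Scoring.CardConsistency

end
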